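import Mathlib
import HarnessLib

/-!
# LatticeQCDFlow / Scaling — bookkeeping for the torus transfer: the factorised acceptance functional
# is invariant under re-indexing and re-centring the blocks; the punctured volume `L² − 1 → ∞`, the
# diagonal coupling `c/√(L² − 1) → 0` and the sandwich factors `e^{±a|β_L|N} → 1`

HONEST FRAMING: exact (Metropolis-corrected) sampling algorithms for lattice gauge theory;
figures of merit are autocorrelation/cost numbers at stated couplings and volumes; no
continuum-physics claim.

Venture `LatticeQCDFlow` (cell pub-lqcd), topic `Scaling`; FANOUT row 3 (`s0-u1-a`, S0-B
implementation A, GEN-21).  NEW WORK of the cell (Mathlib only; elementary; NO definition), split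
off so that the torus limit file `Scaling/TorusDiagonalLimit2D` stays within size.  Row 3's
large-volume laws (`Scaling/IdentityFlowAcceptanceDiagonalLimit`, `CumulantDiagonalLimit`, …) index
the blocks of the factorised sampler by `Fin n` and use a CENTRED block statistic; the torus
comparison of `Scaling/TorusAcceptanceSandwich2D` produces the index set `{x ∈ (ℤ/L)² : x ≠ x₀}` and
the raw statistic `Re tr ρ − N`.  This file supplies the two invariances and the limit bookkeeping:

* §1 `integral_comp_sum_piCongrLeft` (`∫ H(Σᵢ f(zᵢ)) dν^{⊗Fin n} = ∫ H(Σₓ f(yₓ)) dν^{⊗ι}` along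
  `ι ≃ Fin n`, Mathlib's `measurePreserving_piCongrLeft`), **`tiltPi_ratio_reindex`** (the
  acceptance functional `(∫∫ min(e^{βT}, e^{βT′}))/∫e^{βT}`, `T = Σ f`, is invariant under
  re-indexing), **`tiltPi_ratio_add_const`** (and under `f ↦ f + a`: the factor `e^{β·#ι·a}`
  cancels — centring);
* §2 `tendsto_puncturedVolume_atTop` (`(k+2)² − 1 → ∞`), `tendsto_diagCoupling_zero`
  (`c/√((k+2)² − 1) → 0`), `tendsto_exp_mul_abs_one` / `tendsto_exp_neg_mul_abs_one`
  (`β_k → 0 ⇒ e^{±a|β_k|b} → 1`).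

NOT CLAIMED: anything about lattice gauge theory (pure measure-theoretic bookkeeping); nothing
re-scored.
-/

noncomputable section

namespace Summit.Ventures.LatticeQCDFlow.Theory2

open MeasureTheory Filter Finset Real Set
open scoped Topology

/-! ## §1 Re-indexing and re-centring the factorised acceptance functional -/

section Reindex

variable {X : Type*} [MeasurableSpace X] (ν : Measure X) {ι : Type*} [Fintype ι] {n : ℕ}

/-- Re-indexing the blocks along `e : ι ≃ Fin n`: `∫ H(Σ_i f(z_i)) dν^{⊗ Fin n} = ∫ H(Σ_x f(y_x)) dν^{⊗ι}`
(Mathlib's `measurePreserving_piCongrLeft`). [ours] -/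
theorem integral_comp_sum_piCongrLeft [SigmaFinite ν] (e : ι ≃ Fin n) (f : X → ℝ) (H : ℝ → ℝ) :
    ∫ z, H (∑ i, f (z i)) ∂(Measure.pi fun _ : Fin n => ν) =
      ∫ y, H (∑ x, f (y x)) ∂(Measure.pi fun _ : ι => ν) := by
  have hmp := measurePreserving_piCongrLeft (fun _ : Fin n => ν) e
  rw [← hmp.integral_comp']
  refine integral_congr_ae (ae_of_all _ fun y => ?_)
  simp only
  congr 1
  rw [MeasurableEquiv.coe_piCongrLeft]
  exact Fintype.sum_equiv e.symm _ _ fun i => by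
    rw [Equiv.piCongrLeft_apply_eq_cast, cast_eq]

/-- **The factorised acceptance functional is invariant under re-indexing the blocks.** [ours] -/
theorem tiltPi_ratio_reindex [SigmaFinite ν] (e : ι ≃ Fin n) (f : X → ℝ) (β : ℝ) :
    (∫ y, ∫ y', min (Real.exp (β * ∑ x, f (y x))) (Real.exp (β * ∑ x, f (y' x)))
          ∂(Measure.pi fun _ : ι => ν) ∂(Measure.pi fun _ : ι => ν)) /
        ∫ y, Real.exp (β * ∑ x, f (y x)) ∂(Measure.pi fun _ : ι => ν) =
      (∫ z, ∫ z', min (Real.exp (β * ∑ i, f (z i))) (Real.exp (β * ∑ i, f (z' i)))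
          ∂(Measure.pi fun _ : Fin n => ν) ∂(Measure.pi fun _ : Fin n => ν)) /
        ∫ z, Real.exp (β * ∑ i, f (z i)) ∂(Measure.pi fun _ : Fin n => ν) := by
  have hden := integral_comp_sum_piCongrLeft ν e f (fun s => Real.exp (β * s))
  have hin : ∀ s : ℝ, ∫ z', min (Real.exp (β * s)) (Real.exp (β * ∑ i, f (z' i)))
      ∂(Measure.pi fun _ : Fin n => ν) =
      ∫ y', min (Real.exp (β * s)) (Real.exp (β * ∑ x, f (y' x))) ∂(Measure.pi fun _ : ι => ν) :=
    fun s => integral_comp_sum_piCongrLeft ν e f (fun t => min (Real.exp (β * s)) (Real.exp (β * t)))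
  have hnum := integral_comp_sum_piCongrLeft ν e f
    (fun s => ∫ y', min (Real.exp (β * s)) (Real.exp (β * ∑ x, f (y' x))) ∂(Measure.pi fun _ : ι => ν))
  simp only at hden hnum
  simp_rw [hin]
  rw [hnum, hden]

/-- **The factorised acceptance functional is blind to constant shifts of the block statistic**
(centring): the factor `e^{β·#ι·a}` cancels between numerator and partition function. [ours] -/
theorem tiltPi_ratio_add_const (f : X → ℝ) (a β : ℝ) :
    (∫ y, ∫ y', min (Real.exp (β * ∑ x, (f (y x) + a))) (Real.exp (β * ∑ x, (f (y' x) + a)))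
          ∂(Measure.pi fun _ : ι => ν) ∂(Measure.pi fun _ : ι => ν)) /
        ∫ y, Real.exp (β * ∑ x, (f (y x) + a)) ∂(Measure.pi fun _ : ι => ν) =
      (∫ y, ∫ y', min (Real.exp (β * ∑ x, f (y x))) (Real.exp (β * ∑ x, f (y' x)))
          ∂(Measure.pi fun _ : ι => ν) ∂(Measure.pi fun _ : ι => ν)) /
        ∫ y, Real.exp (β * ∑ x, f (y x)) ∂(Measure.pi fun _ : ι => ν) := by
  set C : ℝ := Real.exp (β * (Fintype.card ι * a)) with hC
  have hC0 : C ≠ 0 := (Real.exp_pos _).ne'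
  have e1 : ∀ y : ι → X, Real.exp (β * ∑ x, (f (y x) + a)) = Real.exp (β * ∑ x, f (y x)) * C := by
    intro y
    rw [hC, ← Real.exp_add, Finset.sum_add_distrib, Finset.sum_const, Finset.card_univ, nsmul_eq_mul]
    ring_nf
  have hCnn : 0 ≤ C := (Real.exp_pos _).le
  simp_rw [e1, ← min_mul_of_nonneg _ _ hCnn, integral_mul_const]
  rw [mul_div_mul_right _ _ hC0]

end Reindex

/-! ## §2 The punctured volume `L² − 1 → ∞`, the diagonal coupling `β_L → 0`, the sandwich factors `→ 1` -/

section Subsequence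

/-- `L² − 1 → ∞` along `L = k + 2`. [folklore] -/
theorem tendsto_puncturedVolume_atTop : Tendsto (fun k : ℕ => (k + 2) ^ 2 - 1) atTop atTop := by
  refine tendsto_atTop_mono (fun k => ?_) tendsto_id
  have h : k + 1 ≤ (k + 2) ^ 2 := by nlinarith
  simp only [id_eq]
  omega

/-- The diagonal coupling of the punctured torus, `β_L = c/√(L² − 1) → 0`. [folklore] -/
theorem tendsto_diagCoupling_zero (c : ℝ) :
    Tendsto (fun k : ℕ => c / Real.sqrt ((((k + 2) ^ 2 - 1 : ℕ)) : ℝ)) atTop (𝓝 0) := by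
  refine tendsto_const_nhds.div_atTop ?_
  have h := tendsto_natCast_atTop_atTop (R := ℝ).comp tendsto_puncturedVolume_atTop
  exact (tendsto_rpow_atTop (by norm_num : (0 : ℝ) < 1 / 2)).comp h |>.congr fun k => by
    simp only [Function.comp_apply, Real.sqrt_eq_rpow]

/-- The sandwich factors tend to one: `β_k → 0 ⇒ e^{a|β_k|N} → 1`. [folklore] -/
theorem tendsto_exp_mul_abs_one {β : ℕ → ℝ} (hβ : Tendsto β atTop (𝓝 0)) (a b : ℝ) :
    Tendsto (fun k => Real.exp (a * |β k| * b)) atTop (𝓝 1) := by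
  have h : Tendsto (fun k => a * |β k| * b) atTop (𝓝 (a * |(0 : ℝ)| * b)) :=
    (hβ.abs.const_mul a).mul_const b
  rw [abs_zero, mul_zero, zero_mul] at h
  have := (Real.continuous_exp.tendsto 0).comp h
  rwa [Real.exp_zero] at this

/-- `β_k → 0 ⇒ e^{−(a|β_k|N)} → 1`. [folklore] -/
theorem tendsto_exp_neg_mul_abs_one {β : ℕ → ℝ} (hβ : Tendsto β atTop (𝓝 0)) (a b : ℝ) :
    Tendsto (fun k => Real.exp (-(a * |β k| * b))) atTop (𝓝 1) := by
  have h := tendsto_exp_mul_abs_one hβ (-a) b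
  refine h.congr fun k => ?_
  congr 1; ring

end Subsequence

end Summit.Ventures.LatticeQCDFlow.Theory2

end
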